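import Summits.CriticalPhenomena.PercolationContinuityZ3.Theorems.PercNearOneGluingNoHeavyLowerTailAPLPieceCells
import Summits.CriticalPhenomena.PercolationContinuityZ3.Theorems.PercNearOneGluingNoHeavyLowerTailAPLCellsBasic
import Summits.CriticalPhenomena.PercolationContinuityZ3.Theorems.PercNearOneGluingNoHeavyLowerTailAPLSeriesReduction
import Summits.CriticalPhenomena.PercolationContinuityZ3.Theorems.PercNearOneGluingNoHeavyLowerTailAPLWeakFaceLemma
import HarnessLib

/-!
# `NoHeavyLowerTail` (stmt-CriticalPhenomena-4575) — PARALLEL COMPOSITION WITH AN APEX-FREE TWO-TERMINAL NETWORK PRESERVES `E ≤ 28/27`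

Support file (prover prim-ineq-gen-8 gen 59; `--supports stmt-CriticalPhenomena-4575`; memo
run/shared/lean/prim/prim-ineq-gen-8/FINDING-gen59-WEAKFACE.md).  No definitions, no named facts, no sorries.

The kernel form of the full-simplex shortcut theorem `shortcut_full_le` (`…APLWeakFaceLemma.lean`).  Setting as in `…APLGluedCells.lean` /
`…APLSeriesReduction.lean`: weights `p ∈ [0,1]` on `Sym2 V`, finite weighted probabilities `DecisionTree.PrW D p` of cluster events
(`Gladkov.cl`), apex `o`, ports `u, v`, `E = κ²/(pπm)` with `p = P(u ∈ cl o)`, `π = P(v ∈ cl o)`, `τ = P(both)`, `κ = τ − pπ`,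
`m = P(u ∉ cl o, v ∈ cl u)`.
* `shortcut_cells_le` — `shortcut_full_le` in the five cells `(x₀, B, A, m, τ)` of `(o; u, v)` (sum `1`), including the degenerate cases
  `p = 0` / `π = 0`.
* `conn_eq_cells_b/c`, `m_event_eq_cell`, `PrW_not_conn_eq` — bookkeeping between the events of `series_reduction` and the cells.
* **`shortcut_parallel`** — THE THEOREM: `D₁, D₂` disjoint edge sets glued only at the terminals `o, u, v`, NO edge of `D₂` containing the apex
  `o` (an arbitrary apex-free two-terminal `u–v` network: by `afree_cell_*` its cells are `(P(v ∉ cl u), 0, 0, P(v ∈ cl u), 0)`); if `(o; u, v)`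
  on `D₁` has `E ≤ 28/27` then so does `(o; u, v)` on `D₁ ∪ D₂` (union lemma `glued_cell_*` + `shortcut_cells_le`; Harris for `D₁` is
  `PrW_harris_cl`).  With `series_reduction` (cut vertices, beads) this closes `E ≤ 28/27` under every series–parallel step whose parallel
  factor is apex-free. [this work]
-/

namespace Summit.CriticalPhenomena.PercolationContinuityZ3.Theorems

namespace APL

open Literature.Probability.Percolation Literature.Probability.Percolation.Gladkov Literature.Probability.Percolation.DecisionTree
open scoped Classical

/-- **`shortcut_full_le` in the five cells**, with the degenerate cases.  Cells `x₀ = P(o|u|v)`, `B = P(ou|v)`, `A = P(ov|u)`, `m = P(o|uv)`,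
`τ = P(ouv)`, all `≥ 0`, sum `1`; Harris `(τ+B)(τ+A) ≤ τ`; `E ≤ 28/27`; shortcut probability `w ∈ [0,1]`.  Then the shortcut cells
(`p′ = τ + B + wA`, `π′ = τ + A + wB`, `τ′ = τ + w(A+B)`, `m′ = m + w·x₀`) satisfy `E ≤ 28/27`. [this work] -/
theorem shortcut_cells_le (x0 B A m τ w : ℝ) (h0 : 0 ≤ x0) (hB : 0 ≤ B) (hA : 0 ≤ A) (hm : 0 ≤ m) (hτ : 0 ≤ τ)
    (hsum : x0 + B + A + m + τ = 1) (hH : (τ + B) * (τ + A) ≤ τ)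
    (hE : (τ - (τ + B) * (τ + A)) ^ 2 ≤ 28 / 27 * ((τ + B) * (τ + A)) * m) (hw0 : 0 ≤ w) (hw1 : w ≤ 1) :
    (τ + w * (A + B) - (τ + B + w * A) * (τ + A + w * B)) ^ 2
      ≤ 28 / 27 * ((τ + B + w * A) * (τ + A + w * B)) * (m + w * x0) := by
  have hx0 : x0 = 1 - τ - A - B - m := by linarith
  rcases (add_nonneg hτ hB).eq_or_lt with hp | hp
  · -- p = τ + B = 0: τ = B = 0
    have hτ0 : τ = 0 := by linarith
    have hB0 : B = 0 := by linarith
    subst hτ0; subst hB0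
    have hA1 : A ≤ 1 := by linarith
    have h1 : w * (1 - A) ^ 2 ≤ 28 / 27 * (m + w * x0) := by nlinarith [mul_nonneg hw0 hA, mul_nonneg hm (sub_nonneg.2 hw1)]
    nlinarith [mul_nonneg (mul_nonneg hw0 (sq_nonneg A)) (sub_nonneg.2 h1)]
  rcases (add_nonneg hτ hA).eq_or_lt with hπ | hπ
  · -- π = τ + A = 0
    have hτ0 : τ = 0 := by linarith
    have hA0 : A = 0 := by linarith
    subst hτ0; subst hA0
    have hB1 : B ≤ 1 := by linarith
    have h1 : w * (1 - B) ^ 2 ≤ 28 / 27 * (m + w * x0) := by nlinarith [mul_nonneg hw0 hB, mul_nonneg hm (sub_nonneg.2 hw1)]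
    nlinarith [mul_nonneg (mul_nonneg hw0 (sq_nonneg B)) (sub_nonneg.2 h1)]
  rw [hx0]
  exact shortcut_full_le τ A B m w hτ hA hB hp hπ hH hE hw0 hw1

variable {V : Type*} [Fintype V] [DecidableEq V]

/-- `P(b ∈ cl a) = P(ab|c) + P(abc)`. [folklore] -/
theorem conn_eq_cells_b (p : Sym2 V → ℝ) (D : Finset (Sym2 V)) (a b c : V) :
    PrW D p {K : Finset (Sym2 V) | b ∈ cl K a}
      = PrW D p {K : Finset (Sym2 V) | b ∈ cl K a ∧ c ∉ cl K a} + PrW D p {K : Finset (Sym2 V) | b ∈ cl K a ∧ c ∈ cl K a} := by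
  rw [← PrW_union D p (Set.disjoint_left.2 fun K h1 h2 => h1.2 h2.2)]
  exact PrW_congr_set D p fun K _ => by
    simp only [Set.mem_setOf_eq, Set.mem_union]
    tauto

/-- `P(c ∈ cl a) = P(ac|b) + P(abc)`. [folklore] -/
theorem conn_eq_cells_c (p : Sym2 V → ℝ) (D : Finset (Sym2 V)) (a b c : V) :
    PrW D p {K : Finset (Sym2 V) | c ∈ cl K a}
      = PrW D p {K : Finset (Sym2 V) | c ∈ cl K a ∧ b ∉ cl K a} + PrW D p {K : Finset (Sym2 V) | b ∈ cl K a ∧ c ∈ cl K a} := by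
  rw [← PrW_union D p (Set.disjoint_left.2 fun K h1 h2 => h1.2 h2.1)]
  exact PrW_congr_set D p fun K _ => by
    simp only [Set.mem_setOf_eq, Set.mem_union]
    tauto

/-- The `m`-event of `series_reduction` is the cell `a|bc`: `{b ∉ cl a, c ∈ cl b} = {b ∉ cl a, c ∉ cl a, c ∈ cl b}`. [folklore] -/
theorem m_event_eq_cell (p : Sym2 V → ℝ) (D : Finset (Sym2 V)) (a b c : V) :
    PrW D p {K : Finset (Sym2 V) | b ∉ cl K a ∧ c ∈ cl K b}
      = PrW D p {K : Finset (Sym2 V) | b ∉ cl K a ∧ c ∉ cl K a ∧ c ∈ cl K b} := by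
  refine PrW_congr_set D p fun K _ => ?_
  simp only [Set.mem_setOf_eq]
  exact ⟨fun ⟨h1, h2⟩ => ⟨h1, fun h3 => not_mem_cl_of_mem_cl h3 h1 h2, h2⟩, fun ⟨h1, _, h3⟩ => ⟨h1, h3⟩⟩

/-- `P(c ∉ cl b) = 1 − P(c ∈ cl b)`. [folklore] -/
theorem PrW_not_conn_eq (p : Sym2 V → ℝ) (D : Finset (Sym2 V)) (b c : V) :
    PrW D p {K : Finset (Sym2 V) | c ∉ cl K b} = 1 - PrW D p {K : Finset (Sym2 V) | c ∈ cl K b} := by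
  have h : PrW D p {K : Finset (Sym2 V) | c ∉ cl K b} + PrW D p {K : Finset (Sym2 V) | c ∈ cl K b} = 1 := by
    rw [← PrW_union D p (Set.disjoint_left.2 fun K h1 h2 => by simp only [Set.mem_setOf_eq] at h1 h2; exact h1 h2),
      ← PrW_univ D p]
    exact PrW_congr_set D p fun K _ => by
      simp only [Set.mem_setOf_eq, Set.mem_union, Set.mem_univ, iff_true]
      tauto
  linarith

/-- **PARALLEL COMPOSITION WITH AN APEX-FREE NETWORK PRESERVES `E ≤ 28/27`.**  Let `D₁, D₂` be disjoint edge sets such that every vertex meeting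
both is one of the terminals `o, u, v`, no edge of `D₂` contains the apex `o`, `u ≠ v`, `u, v ≠ o`, weights `p ∈ [0,1]`.  If `(o; u, v)` on `D₁`
satisfies `E ≤ 28/27`, i.e. `(P(u,v ∈ cl o) − P(u ∈ cl o)P(v ∈ cl o))² ≤ (28/27)·P(u ∈ cl o)·P(v ∈ cl o)·P(u ∉ cl o, v ∈ cl u)`, then so does
`(o; u, v)` on `D₁ ∪ D₂`.  The apex-free network `D₂` acts on the cells of `D₁` as the shortcut of probability `w = P_{D₂}(v ∈ cl u)`
(`afree_cell_*`, `glued_cell_*`), and `shortcut_cells_le` applies (Harris for `D₁` by `PrW_harris_cl`).  The constant `28/27` is sharp for this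
statement in the weak-apex limit (`shortcut_first_order_sharp`). [this work] -/
theorem shortcut_parallel (p : Sym2 V → ℝ) (hp0 : ∀ e, 0 ≤ p e) (hp1 : ∀ e, p e ≤ 1)
    (D₁ D₂ : Finset (Sym2 V)) (hdisj : Disjoint D₁ D₂) (o u v : V)
    (hsep : ∀ x : V, (∃ e ∈ D₁, x ∈ e) → (∃ e ∈ D₂, x ∈ e) → (x = o ∨ x = u ∨ x = v))
    (hD₂ : ∀ f ∈ D₂, o ∉ f) (huo : u ≠ o) (hvo : v ≠ o)
    (hE : (PrW D₁ p {K : Finset (Sym2 V) | u ∈ cl K o ∧ v ∈ cl K o}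
        - PrW D₁ p {K : Finset (Sym2 V) | u ∈ cl K o} * PrW D₁ p {K : Finset (Sym2 V) | v ∈ cl K o}) ^ 2
        ≤ 28 / 27 * PrW D₁ p {K : Finset (Sym2 V) | u ∈ cl K o} * PrW D₁ p {K : Finset (Sym2 V) | v ∈ cl K o}
          * PrW D₁ p {K : Finset (Sym2 V) | u ∉ cl K o ∧ v ∈ cl K u}) :
    (PrW (D₁ ∪ D₂) p {K : Finset (Sym2 V) | u ∈ cl K o ∧ v ∈ cl K o}
        - PrW (D₁ ∪ D₂) p {K : Finset (Sym2 V) | u ∈ cl K o} * PrW (D₁ ∪ D₂) p {K : Finset (Sym2 V) | v ∈ cl K o}) ^ 2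
      ≤ 28 / 27 * PrW (D₁ ∪ D₂) p {K : Finset (Sym2 V) | u ∈ cl K o} * PrW (D₁ ∪ D₂) p {K : Finset (Sym2 V) | v ∈ cl K o}
        * PrW (D₁ ∪ D₂) p {K : Finset (Sym2 V) | u ∉ cl K o ∧ v ∈ cl K u} := by
  have hH := PrW_harris_cl D₁ hp0 hp1 o u v
  rw [conn_eq_cells_b p D₁ o u v, conn_eq_cells_c p D₁ o u v, m_event_eq_cell p D₁ o u v] at hE
  rw [conn_eq_cells_b p D₁ o u v, conn_eq_cells_c p D₁ o u v] at hH
  rw [conn_eq_cells_b p (D₁ ∪ D₂) o u v, conn_eq_cells_c p (D₁ ∪ D₂) o u v, m_event_eq_cell p (D₁ ∪ D₂) o u v,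
    glued_cell_ab p D₁ D₂ hdisj o u v hsep, glued_cell_ac p D₁ D₂ hdisj o u v hsep, glued_cell_bc p D₁ D₂ hdisj o u v hsep,
    glued_cell_three p D₁ D₂ hdisj o u v hsep,
    afree_cell_zero p D₂ o u v huo hvo hD₂, afree_cell_ab p D₂ o u v huo hD₂, afree_cell_ac p D₂ o u v hvo hD₂,
    afree_cell_bc p D₂ o u v huo hvo hD₂, afree_cell_three p D₂ o u v huo hD₂, PrW_not_conn_eq p D₂ u v]
  set Z1 := PrW D₁ p {K : Finset (Sym2 V) | u ∉ cl K o ∧ v ∉ cl K o ∧ v ∉ cl K u} with hZ1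
  set B1 := PrW D₁ p {K : Finset (Sym2 V) | u ∈ cl K o ∧ v ∉ cl K o} with hB1
  set A1 := PrW D₁ p {K : Finset (Sym2 V) | v ∈ cl K o ∧ u ∉ cl K o} with hA1
  set M1 := PrW D₁ p {K : Finset (Sym2 V) | u ∉ cl K o ∧ v ∉ cl K o ∧ v ∈ cl K u} with hM1
  set T1 := PrW D₁ p {K : Finset (Sym2 V) | u ∈ cl K o ∧ v ∈ cl K o} with hT1
  set W2 := PrW D₂ p {K : Finset (Sym2 V) | v ∈ cl K u} with hW2
  have hZ : 0 ≤ Z1 := PrW_nonneg D₁ hp0 hp1 _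
  have hBn : 0 ≤ B1 := PrW_nonneg D₁ hp0 hp1 _
  have hAn : 0 ≤ A1 := PrW_nonneg D₁ hp0 hp1 _
  have hMn : 0 ≤ M1 := PrW_nonneg D₁ hp0 hp1 _
  have hTn : 0 ≤ T1 := PrW_nonneg D₁ hp0 hp1 _
  have hW0 : 0 ≤ W2 := PrW_nonneg D₂ hp0 hp1 _
  have hW1 : W2 ≤ 1 := PrW_cl_le_one D₂ hp0 hp1 _
  have hsum : Z1 + B1 + A1 + M1 + T1 = 1 := cells_sum_eq_one p D₁ o u v
  have hH' : (T1 + B1) * (T1 + A1) ≤ T1 := by nlinarith [hH]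
  have hE' : (T1 - (T1 + B1) * (T1 + A1)) ^ 2 ≤ 28 / 27 * ((T1 + B1) * (T1 + A1)) * M1 := by
    have e1 : (T1 - (T1 + B1) * (T1 + A1)) ^ 2 = (T1 - (B1 + T1) * (A1 + T1)) ^ 2 := by ring
    have e2 : 28 / 27 * ((T1 + B1) * (T1 + A1)) * M1 = 28 / 27 * (B1 + T1) * (A1 + T1) * M1 := by ring
    rw [e1, e2]; exact hE
  have key := shortcut_cells_le Z1 B1 A1 M1 T1 W2 hZ hBn hAn hMn hTn hsum hH' hE' hW0 hW1
  convert key using 1 <;> ring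

end APL

end Summit.CriticalPhenomena.PercolationContinuityZ3.Theorems
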